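/-
Copyright: the b2b-balaban cell (near-miss cell 7), T⁴-continuum fan-out; row NE7b swarm table S4, seat
`t4-ne7b-formalise-leaf-02`.  Released under the licence of the surrounding project.
-/
import Summits.QuantumFields.BalabanUV.T4Continuum.Support.LateMergers
import Summits.QuantumFields.BalabanUV.T4Continuum.Support.ZoneTransport

/-!
# Row NE7b, leaf S4 (H2b) — part 1: consistency, well-formedness and pendency TRANSPORT from a tagged genealogy to its shape

Summits-side support leaf of the T⁴-continuum cell (rung (B)+1 on a FINITE torus only; NOT infinite volume, NOT the
mass gap, NOT the Clay statement; NOT a proof of the spine estimate NE7b).  Claim table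
`t4/b2b-balaban-t4-ne7b-p1/LEAVES-NE7b.md` row S4 «H2b consistent ∧ WF ∧ pending» (the three (H2b) fields of
`HistorySocket.LiveHistories` ∕ `HistorySocketTagged.LiveHistoriesT`).  [folklore] bookkeeping over the lineage's OWN
typed carrier (`T4PersistenceDictionary.Gen`, `T4PrintedShapeBanking.Consistent`, `T4TaggedShapeBanking.ConsistentT`,
`LateMergers.FreshT`, `T4BranchingRecordsGas.relabel`); nothing is quoted from print, nothing printed is asserted, no
`def … : Prop` fact is minted (trigger condition c1), no `[cite:]` tag.

WHY.  Leaf S3 (`HistoryGen`) builds the genealogy of a live component as a TAGGED tree `G̃ : Gen ε` over the history's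
own region ∕ component names (events pairwise distinct for free) together with a shape map `sh : ε → PEv`, and hands the
socket the flat genealogy `relabel sh G̃ : Gen PEv` (journal «Q NE7b-S1∕S3», swarm seat leaf-09).  The socket's (H2b)
fields are stated for the FLAT genealogy and the flat window table `dictW (R K) C.n₁`.  This part of S4 is the
S3-independent half: the three fields TRANSPORT along `relabel sh` —
* `Consistent C K R (relabel sh G̃) ↔ ConsistentT sh C K R G̃` (no hypothesis on the tags);
* `(relabel sh G̃).WF (dictW R C.n₁)` from `ConsistentT` + `FreshT` + injectivity of `sh` ON THE EVENTS OF `G̃` (the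
  displayed label-genericity hypothesis «no two parallel events of one component have the same shape»; without it the
  flat tree is not well formed, cf. `T4TaggedShapeBanking.Zflat_not_WF`);
* `K < (relabel sh G̃).reach (dictW R C.n₁) ↔ K < G̃.reach (dictWT sh R C.n₁)`.
Part 2 (the fields for S3's `liveGen`, by recursion over `HistoryAdmissible`) follows when S1∕S3 land.

WHAT.  §1 `relabel_eq_gmap` (the two push-forwards of the tree coincide: `T4BranchingRecordsGas.relabel` =
`ZoneSkeleton.gmap`), `events_relabel`.  §2 `consistent_relabel_iff`.  §3 `freshT_relabel_of_injOn`,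
`wf_relabel_of_injOn` (the `Set.InjOn`-on-events sharpening of `ZoneSkeleton.wf_gmap`).  §4 the three (H2b) fields of a
shape: `consistent_shape`, `wf_shape`, `pending_shape_iff`, bundled `h2b_shape`.  §5 Sanity on the lineage's decided
two-partner genealogy `T4TaggedShapeBanking.Zt` (tags `Prod.fst`-shaped): the transport applies, and WITHOUT
injectivity it is genuinely false (`Zflat_not_WF`).  §6 (v1.1, APPENDED after ruling R-OWNER-22-1: the assembly targets the TH exit, ONE
shape function): `dictWT_shape_comp`, `consistentT_shape_comp_iff`, `consistentT_iff_shapeTree` ∕ `consistentT_of_shapeTree`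
(`ConsistentT sh G′ ↔ Consistent (relabel (shape ∘ sh) G′)` — S1's `PGen.consistent_toGen` through S3's `shape_genT`
discharges the TH socket's `consistent`), `pending_iff_shapeTree`.

HONEST DEPENDENCY (cell): continuum YM on T⁴ ⇐ BetaPertH ∧ nine spine estimates (0/9 proved); BetaPertH ⇐ (D1) ∧ (D4)
∧ CAP+tail.  This file changes none of it.
-/

open Finset
open Literature.MathematicalPhysics.QuantumFieldTheory.Balaban1983to89
open T4PersistenceDictionary T4PrintedShapeBanking T4BranchingRecordsGas T4TaggedShapeBanking
open Summit.QuantumFields.BalabanUV.T4Continuum.LateMergers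
open Summit.QuantumFields.BalabanUV.T4Continuum.ZoneSkeleton

namespace Summit.QuantumFields.BalabanUV.T4Continuum.HistoryConsistent

/-! ## §1 The two push-forwards agree; events of a relabelled tree -/

section Relabel

variable {ε δ : Type*}

/-- `T4BranchingRecordsGas.relabel` and `ZoneSkeleton.gmap` are the same push-forward of a genealogy along a map of
labels (so the zone chain's `gmap` lemmas apply to S3's `relabel`). [folklore] -/
theorem relabel_eq_gmap (f : ε → δ) : ∀ G : Gen ε, relabel f G = gmap f G
  | Gen.born _ _ => rfl
  | Gen.renew G e h => by rw [relabel_renew, relabel_eq_gmap f G]; rfl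
  | Gen.merge X Y e => by rw [relabel_merge, relabel_eq_gmap f X, relabel_eq_gmap f Y]; rfl

variable [DecidableEq ε] [DecidableEq δ]

/-- the events of a relabelled genealogy are the image of its events [folklore] -/
theorem events_relabel (f : ε → δ) (G : Gen ε) : (relabel f G).events = G.events.image f := by
  rw [relabel_eq_gmap, events_gmap]

end Relabel

/-! ## §2 Consistency transports along the shape map, both ways, with no hypothesis on the tags -/

section Consistent

variable {ε : Type*} (sh : ε → PEv) (C : T4PrintedShapeBanking.Consts) (K : ℕ) (R : ℕ → ℕ)

/-- **CONSISTENCY OF THE SHAPE = TAGGED CONSISTENCY**: `T4PrintedShapeBanking.Consistent` of `relabel sh G̃` is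
`T4TaggedShapeBanking.ConsistentT sh` of `G̃` — same kinds, steps, readiness and life conditions, the reach being
invariant under relabelling (`reach_relabel`). [folklore] -/
theorem consistent_relabel_iff : ∀ G : Gen ε, Consistent C K R (relabel sh G) ↔ ConsistentT sh C K R G
  | Gen.born _ _ => Iff.rfl
  | Gen.renew G e h => by
      simp only [relabel_renew, Consistent, ConsistentT, consistent_relabel_iff G,
        reach_relabel sh (W := dictWT sh R C.n₁) (W' := dictW R C.n₁) (fun _ => rfl)]
  | Gen.merge X Y e => by
      simp only [relabel_merge, Consistent, ConsistentT, consistent_relabel_iff X, consistent_relabel_iff Y,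
        rootStep_relabel, reach_relabel sh (W := dictWT sh R C.n₁) (W' := dictW R C.n₁) (fun _ => rfl)]

end Consistent

/-! ## §3 Freshness and well-formedness transport along a map injective ON THE EVENTS -/

section Fresh

variable {ε δ : Type*} [DecidableEq ε] [DecidableEq δ]

/-- freshness (pairwise-distinct events) transports along a map injective on the events. [folklore] -/
theorem freshT_relabel_of_injOn (f : ε → δ) :
    ∀ {G : Gen ε}, FreshT G → Set.InjOn f ↑G.events → FreshT (relabel f G)
  | Gen.born _ _, _, _ => trivial
  | Gen.renew G e h, hf, hinj => by
      simp only [FreshT] at hf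
      obtain ⟨hG, he⟩ := hf
      have hsub : (↑G.events : Set ε) ⊆ ↑(Gen.renew G e h).events := by
        rw [Gen.events_renew, coe_insert]; exact Set.subset_insert _ _
      refine ⟨freshT_relabel_of_injOn f hG (hinj.mono hsub), ?_⟩
      rw [events_relabel, mem_image]
      rintro ⟨e₀, he₀, hfe⟩
      have : e₀ = e := hinj (hsub he₀) (by simp) hfe
      exact he (this ▸ he₀)
  | Gen.merge X Y e, hf, hinj => by
      simp only [FreshT] at hf
      obtain ⟨hX, hY, heX, heY, hd⟩ := hf
      have hsubX : (↑X.events : Set ε) ⊆ ↑(Gen.merge X Y e).events := fun x hx => by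
        rw [mem_coe, Gen.events_merge, mem_insert, mem_union]; exact Or.inr (Or.inl hx)
      have hsubY : (↑Y.events : Set ε) ⊆ ↑(Gen.merge X Y e).events := fun x hx => by
        rw [mem_coe, Gen.events_merge, mem_insert, mem_union]; exact Or.inr (Or.inr hx)
      have he' : e ∈ (↑(Gen.merge X Y e).events : Set ε) := by simp
      refine ⟨freshT_relabel_of_injOn f hX (hinj.mono hsubX), freshT_relabel_of_injOn f hY (hinj.mono hsubY),
        ?_, ?_, ?_⟩
      · rw [events_relabel, mem_image]
        rintro ⟨e₀, he₀, hfe⟩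
        have : e₀ = e := hinj (hsubX he₀) he' hfe
        exact heX (this ▸ he₀)
      · rw [events_relabel, mem_image]
        rintro ⟨e₀, he₀, hfe⟩
        have : e₀ = e := hinj (hsubY he₀) he' hfe
        exact heY (this ▸ he₀)
      · rw [events_relabel, events_relabel, disjoint_left]
        intro x hxX hxY
        obtain ⟨a, ha, rfl⟩ := mem_image.1 hxX
        obtain ⟨b, hb, hab⟩ := mem_image.1 hxY
        have : b = a := hinj (hsubY hb) (hsubX ha) hab
        exact disjoint_left.1 hd ha (this ▸ hb)

/-- **WELL-FORMEDNESS TRANSPORTS ALONG A MAP INJECTIVE ON THE EVENTS** (window table `W'` on the target, `W' ∘ f` on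
the source; the `Set.InjOn` sharpening of `ZoneSkeleton.wf_gmap`). [folklore] -/
theorem wf_relabel_of_injOn (f : ε → δ) (W' : δ → ℕ) :
    ∀ {G : Gen ε}, G.WF (W' ∘ f) → Set.InjOn f ↑G.events → (relabel f G).WF W'
  | Gen.born _ _, _, _ => trivial
  | Gen.renew G e h, hW, hinj => by
      obtain ⟨hG, he, h1, h2⟩ := hW
      have hsub : (↑G.events : Set ε) ⊆ ↑(Gen.renew G e h).events := by
        rw [Gen.events_renew, coe_insert]; exact Set.subset_insert _ _
      refine ⟨wf_relabel_of_injOn f W' hG (hinj.mono hsub), ?_, ?_, ?_⟩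
      · rw [events_relabel, mem_image]
        rintro ⟨e₀, he₀, hfe⟩
        have : e₀ = e := hinj (hsub he₀) (by simp) hfe
        exact he (this ▸ he₀)
      · rwa [rootStep_relabel]
      · rwa [reach_relabel f (W := W' ∘ f) (W' := W') (fun _ => rfl)]
  | Gen.merge X Y e, hW, hinj => by
      obtain ⟨hX, hY, heX, heY, hd, h1, h2⟩ := hW
      have hsubX : (↑X.events : Set ε) ⊆ ↑(Gen.merge X Y e).events := fun x hx => by
        rw [mem_coe, Gen.events_merge, mem_insert, mem_union]; exact Or.inr (Or.inl hx)
      have hsubY : (↑Y.events : Set ε) ⊆ ↑(Gen.merge X Y e).events := fun x hx => by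
        rw [mem_coe, Gen.events_merge, mem_insert, mem_union]; exact Or.inr (Or.inr hx)
      have he' : e ∈ (↑(Gen.merge X Y e).events : Set ε) := by simp
      refine ⟨wf_relabel_of_injOn f W' hX (hinj.mono hsubX), wf_relabel_of_injOn f W' hY (hinj.mono hsubY),
        ?_, ?_, ?_, ?_, ?_⟩
      · rw [events_relabel, mem_image]
        rintro ⟨e₀, he₀, hfe⟩
        have : e₀ = e := hinj (hsubX he₀) he' hfe
        exact heX (this ▸ he₀)
      · rw [events_relabel, mem_image]
        rintro ⟨e₀, he₀, hfe⟩
        have : e₀ = e := hinj (hsubY he₀) he' hfe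
        exact heY (this ▸ he₀)
      · rw [events_relabel, events_relabel, disjoint_left]
        intro x hxX hxY
        obtain ⟨a, ha, rfl⟩ := mem_image.1 hxX
        obtain ⟨b, hb, hab⟩ := mem_image.1 hxY
        have : b = a := hinj (hsubY hb) (hsubX ha) hab
        exact disjoint_left.1 hd ha (this ▸ hb)
      · rwa [rootStep_relabel, reach_relabel f (W := W' ∘ f) (W' := W') (fun _ => rfl)]
      · rwa [rootStep_relabel, reach_relabel f (W := W' ∘ f) (W' := W') (fun _ => rfl)]

end Fresh

/-! ## §4 The three (H2b) fields of a shape -/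

section H2b

variable {ε : Type*} [DecidableEq ε] {sh : ε → PEv} {C : T4PrintedShapeBanking.Consts} {K : ℕ} {R : ℕ → ℕ}
  {G : Gen ε}

omit [DecidableEq ε] in
/-- (H2b-1) **the shape of a consistent tagged genealogy is consistent**. [folklore] -/
theorem consistent_shape (hc : ConsistentT sh C K R G) : Consistent C K R (relabel sh G) :=
  (consistent_relabel_iff sh C K R G).2 hc

omit [DecidableEq ε] in
/-- … and conversely. [folklore] -/
theorem consistentT_of_shape (hc : Consistent C K R (relabel sh G)) : ConsistentT sh C K R G :=
  (consistent_relabel_iff sh C K R G).1 hc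

/-- (H2b-2) **the shape of a consistent, fresh tagged genealogy is well formed for the flat table**, PROVIDED the shape
map separates its events (timing from consistency via `LateMergers.wf_of_consistentT_freshT`, distinctness transported
by `wf_relabel_of_injOn`). [folklore] -/
theorem wf_shape (hc : ConsistentT sh C K R G) (hf : FreshT G) (hinj : Set.InjOn sh ↑G.events) :
    (relabel sh G).WF (dictW R C.n₁) :=
  wf_relabel_of_injOn sh (dictW R C.n₁) (wf_of_consistentT_freshT hc hf) hinj

omit [DecidableEq ε] in
/-- (H2b-3) **pendency is a property of the shape**: `K < reach` before and after relabelling are the same statement.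
[folklore] -/
theorem pending_shape_iff (sh : ε → PEv) (R : ℕ → ℕ) (n₁ K : ℕ) (G : Gen ε) :
    K < (relabel sh G).reach (dictW R n₁) ↔ K < G.reach (dictWT sh R n₁) := by
  rw [reach_relabel sh (W := dictWT sh R n₁) (W' := dictW R n₁) (fun _ => rfl)]

/-- **THE THREE (H2b) FIELDS AT ONCE** for the shape of a tagged genealogy: consistent, well formed, pending.
[folklore] -/
theorem h2b_shape (hc : ConsistentT sh C K R G) (hf : FreshT G) (hinj : Set.InjOn sh ↑G.events)
    (hK : K < G.reach (dictWT sh R C.n₁)) :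
    Consistent C K R (relabel sh G) ∧ (relabel sh G).WF (dictW R C.n₁) ∧
      K < (relabel sh G).reach (dictW R C.n₁) :=
  ⟨consistent_shape hc, wf_shape hc hf hinj, (pending_shape_iff sh R C.n₁ K G).2 hK⟩

/-- The root data of the shape (for the slot fields of S7): root step unchanged, root = shape of the root, record =
image of the record when the shape map separates the events. [folklore] -/
theorem record_shape (sh : ε → PEv) (G : Gen ε) (hinj : Set.InjOn sh ↑G.events) :
    (relabel sh G).rootStep = G.rootStep ∧ (relabel sh G).root = sh G.root ∧
      (relabel sh G).events.erase (relabel sh G).root = (G.events.erase G.root).image sh := by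
  refine ⟨rootStep_relabel sh G, root_relabel sh G, ?_⟩
  rw [events_relabel, root_relabel]
  ext x
  simp only [mem_erase, mem_image]
  constructor
  · rintro ⟨hx, a, ha, rfl⟩
    exact ⟨a, ⟨fun h => hx (by rw [h]), ha⟩, rfl⟩
  · rintro ⟨a, ⟨hne, ha⟩, rfl⟩
    exact ⟨fun h => hne (hinj ha G.root_mem h), a, ha, rfl⟩

end H2b

/-! ## §5 Sanity: the transport on the lineage's decided two-branch history `T4TaggedShapeBanking.Sanity.Zt` -/

namespace Sanity

open T4TaggedShapeBanking.Sanity T4PrintedShapeBanking.XreadC4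

/-- CONSISTENCY needs nothing of the tags: the shape `Zflat = relabel Prod.fst Zt` of the consistent tagged history `Zt`
(two equal-class regions born at step `0`, both renewed at `4`, merged at `5`; table `R ≡ 2`, constants `C₀`, cutoff `8`)
is consistent — although it is NOT well formed (`Zflat_not_WF`). [folklore] -/
example : Consistent C₀ 8 (fun _ => 2) Zflat := relabel_fst_Zt ▸ consistent_shape Zt_consistent.1

/-- PENDENCY transports: `8 < reach Zflat`. [folklore] -/
example : 8 < Zflat.reach (dictW (fun _ => 2) C₀.n₁) :=
  relabel_fst_Zt ▸ (pending_shape_iff Prod.fst (fun _ => 2) C₀.n₁ 8 Zt).2 Zt_consistent.2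

/-- THE INJECTIVITY HYPOTHESIS OF `wf_shape` IS NECESSARY: `Zt` is consistent and fresh, its shape is not well formed,
hence `Prod.fst` is NOT injective on the events of `Zt` (the two births share the shape `(0,0,0)`). [folklore] -/
example : ¬ Set.InjOn Prod.fst (↑Zt.events : Set TEv) := fun hinj =>
  Zflat_not_WF _ (relabel_fst_Zt ▸ wf_shape Zt_consistent.1 (FreshT.of_wf _ Zt_wf) hinj)

/-- A POSITIVE instance: one branch `Xt` alone (birth `((0,0,0),0)`, renewal `((4,1,0),0)`) has shape-separated events,
so all three (H2b) fields of its shape hold at cutoff `5 < 7 = reach`. [folklore] -/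
example : Consistent C₀ 5 (fun _ => 2) (relabel Prod.fst Xt) ∧ (relabel Prod.fst Xt).WF (dictW (fun _ => 2) C₀.n₁) ∧
    5 < (relabel Prod.fst Xt).reach (dictW (fun _ => 2) C₀.n₁) := by
  refine h2b_shape ?_ ?_ ?_ ?_
  · simp [ConsistentT, Xt, C₀, Gen.reach, dictW, PEv.kind, PEv.step, PEv.fat, fatWait]
  · simp [FreshT, Xt]
  · intro a ha b hb h
    simp only [Xt, Gen.events_renew, Gen.events_born, coe_insert, coe_singleton, Set.mem_insert_iff,
      Set.mem_singleton_iff] at ha hb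
    rcases ha with rfl | rfl <;> rcases hb with rfl | rfl <;> simp_all
  · simp [Xt, C₀, dictW, PEv.kind]

end Sanity

/-! ## §6 ONE shape function (v1.1, ruling R-OWNER-22-1 R1∕R3): consistency through `shape ∘ sh` is consistency through `sh`

The NE7b assembly now targets the TH exit `CountThresholdExit.relWeightBound_lateMergers_of_irThreshold (sh)` at
`D = 0`, whose socket (v3, `HistorySocketTH`) asks per live member `(z, G′)`, `G′ : Gen ε`: `ConsistentT sh C K (R K) G′`,
`FreshT G′`, `K < G′.reach (dictWT sh (R K) C.n₁)`; and S3 exports ONE shape function `shape_genT : relabel (shape ∘ sh)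
(genT …) = PGen.toGen …` onto S1's skeleton, for which `HistoryAdmissible.PGen.consistent_toGen` gives `Consistent`.
This section is the two-line bridge: the window table, `ConsistentT` and pendency do not see the difference between
`sh` and `shape ∘ sh` (`T4BranchingRecordsGas.dictW_shape`, `kind_shape`, `step_shape`), so `ConsistentT sh … G′` and
`K < reach` follow from the same facts for the SHAPE TREE `relabel (shape ∘ sh) G′` (§2∕§4 with `shape ∘ sh` for `sh`).
[folklore] -/

section Shape

variable {ε : Type*} (sh : ε → PEv)

/-- the tagged window table read through `shape ∘ sh` IS the one read through `sh`. [folklore] -/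
theorem dictWT_shape_comp (R : ℕ → ℕ) (n₁ : ℕ) : dictWT (shape ∘ sh) R n₁ = dictWT sh R n₁ := by
  funext e
  simp only [dictWT_apply, Function.comp_apply, dictW_shape]

/-- **`ConsistentT` THROUGH `shape ∘ sh` ↔ THROUGH `sh`** (kinds, steps and windows are shape-invariant). [folklore] -/
theorem consistentT_shape_comp_iff (C : T4PrintedShapeBanking.Consts) (K : ℕ) (R : ℕ → ℕ) :
    ∀ G : Gen ε, ConsistentT (shape ∘ sh) C K R G ↔ ConsistentT sh C K R G
  | Gen.born _ _ => by
      simp only [ConsistentT, Function.comp_apply, kind_shape, step_shape]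
  | Gen.renew G e h => by
      simp only [ConsistentT, consistentT_shape_comp_iff C K R G, Function.comp_apply, kind_shape, step_shape,
        dictWT_shape_comp]
  | Gen.merge X Y e => by
      simp only [ConsistentT, consistentT_shape_comp_iff C K R X, consistentT_shape_comp_iff C K R Y,
        Function.comp_apply, kind_shape, step_shape, dictWT_shape_comp]

variable {sh} {C : T4PrintedShapeBanking.Consts} {K : ℕ} {R : ℕ → ℕ} {G : Gen ε}

/-- **THE S3∕S12 BRIDGE ON THE TH ROUTE**: `ConsistentT sh` of a tagged genealogy ↔ `Consistent` of its SHAPE TREE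
`relabel (shape ∘ sh) G` — so S1's `PGen.consistent_toGen` (through S3's `shape_genT`) discharges the socket field
`consistent`. [folklore] -/
theorem consistentT_iff_shapeTree : ConsistentT sh C K R G ↔ Consistent C K R (relabel (shape ∘ sh) G) := by
  rw [consistent_relabel_iff (shape ∘ sh) C K R G, consistentT_shape_comp_iff sh C K R G]

/-- … the direction the assembly uses. [folklore] -/
theorem consistentT_of_shapeTree (h : Consistent C K R (relabel (shape ∘ sh) G)) : ConsistentT sh C K R G :=
  consistentT_iff_shapeTree.2 h

/-- **PENDENCY ON THE TH ROUTE**: `K < reach` of the tagged genealogy for `dictWT sh` ↔ of its shape tree for the flat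
table (`T4TaggedShapeBanking.reach_relabel_shapeT`). [folklore] -/
theorem pending_iff_shapeTree (sh : ε → PEv) (R : ℕ → ℕ) (n₁ K : ℕ) (G : Gen ε) :
    K < G.reach (dictWT sh R n₁) ↔ K < (relabel (shape ∘ sh) G).reach (dictW R n₁) := by
  rw [reach_relabel_shapeT]

end Shape

end Summit.QuantumFields.BalabanUV.T4Continuum.HistoryConsistent
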